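import Mathlib
import Summits.Ventures.PercRepro2.Defs
import Summits.Ventures.PercRepro2.Harris
import Summits.Ventures.PercRepro2.Graph
import Summits.Ventures.PercRepro2.Exploration
import Summits.Ventures.PercRepro2.Events
import Summits.Ventures.PercRepro2.CutVertexDefs
import Summits.Ventures.PercRepro2.CDCutVertex
import Summits.Ventures.PercRepro2.TCutVertex

/-!
# (T_h) across a cut vertex with a MIXED up-set «near ∧ far» (blind cell PercRepro2, mine-a g46;
MINE-A.md §101.5 (g))

The companion of `TCutVertexOr`: cut vertex `x`, root `s ∈ VA`, hit vertex `h ∈ VB`, the up-set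
`𝓤 = 𝓤_A ∩ 𝓤_B` the INTERSECTION of an up-set read on the root side and one read beyond the cut
(`∅ ∉ 𝓤_B`), and `𝓥` read beyond the cut.  Then `U = {s ↔ x, C_s ∈ 𝓤_A inside A} ∩ {C_x ∈ 𝓤_B inside B}`
and every one of the seven events is «A-side ∩ B-side»; with `α = P_A(s ↔ x, C_s ∈ 𝓤_A)`,

  **`T(p; s, h; 𝓤_A ∩ 𝓤_B, 𝓥) = α · [(1 − ξ) · P_B(Q_B ∩ U_B ∩ e_B) + ξ · T_B]`**   (`t_cut_and_identity`),

so (T) on the far side with root `x` and the up-sets `𝓤_B`, `𝓥` gives (T_h) on `G` (`t_of_cut_and`).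
No definition; one seat.
-/

namespace Summit.Ventures.PercRepro2

namespace TCutVertexAnd

open CutV

variable {V : Type*} {E : Type*} [Fintype E] [DecidableEq E]
  {R : Type*} [Field R] [LinearOrder R] [IsStrictOrderedRing R]
variable {ends : E → Sym2 V} {x : V} {VA VB : Set V} {EA EB : Set E}
  [DecidablePred (· ∈ EA)] [DecidablePred (· ∈ EB)]

omit [LinearOrder R] [IsStrictOrderedRing R] in
/-- `P({A-side event} ∩ {B-side event}) = P_{p_A}(·) · P_{p_B}(·)`. -/
lemma prob_side_inter_side' (p : E → R) (h : IsCut ends x VA VB EA EB) (X Y : Set (Config E)) :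
    prob p (sideEvent EA X ∩ sideEvent EB Y) =
      prob (fun e => if e ∈ EA then p e else 0) X * prob (fun e => if e ∈ EB then p e else 0) Y := by
  rw [prob_sideEvent_inter_eq_mul p h, CDCutVertex.prob_zeroOff_eq_prob_sideEvent p EA X,
    CDCutVertex.prob_zeroOff_eq_prob_sideEvent p EB Y]

/-! ## The mixed up-set «near ∧ far» -/
section And

omit [Fintype E] [DecidableEq E] [Field R] [LinearOrder R] [IsStrictOrderedRing R]
  [DecidablePred (· ∈ EA)] [DecidablePred (· ∈ EB)] in
/-- The cluster event of an intersection of up-sets is the intersection of the cluster events. -/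
lemma clusterInEvent_inter (s : V) (𝓐 𝓑 : Set (Set V)) :
    clusterInEvent ends s (𝓐 ∩ 𝓑) = clusterInEvent ends s 𝓐 ∩ clusterInEvent ends s 𝓑 := by
  ext ω
  simp only [mem_clusterInEvent, Set.mem_inter_iff]

omit [LinearOrder R] [IsStrictOrderedRing R] in
/-- **The (T)-form across the cut with the mixed up-set `𝓤_A ∩ 𝓤_B`**: with
`α = P_A(s ↔ x, C_s ∈ 𝓤_A)`, `T = α · ((1 − ξ) · P_B(Q_B ∩ U_B ∩ e_B) + ξ · T_B)`. -/
theorem t_cut_and_identity (p : E → R) (h : IsCut ends x VA VB EA EB) {s hv : V} (hs : s ∈ VA)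
    (hvB : hv ∈ VB) {𝓤A 𝓤B 𝓥 : Set (Set V)} (h𝓤A : ∀ S, S ∈ 𝓤A ↔ S ∩ (VA ∪ {x}) ∈ 𝓤A)
    (h𝓤B : ∀ S, S ∈ 𝓤B ↔ S ∩ VB ∈ 𝓤B) (h𝓤B0 : ∅ ∉ 𝓤B)
    (h𝓥 : ∀ S, S ∈ 𝓥 ↔ S ∩ VB ∈ 𝓥) (h𝓥0 : ∅ ∉ 𝓥) :
    prob p (clusterInEvent ends s {T : Set V | hv ∈ T} ∩ clusterInEvent ends s (𝓤A ∩ 𝓤B) ∩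
        clusterInEvent ends s 𝓥) +
      prob p (clusterInEvent ends s {T : Set V | hv ∈ T}) *
        prob p (clusterInEvent ends s (𝓤A ∩ 𝓤B) ∩ clusterInEvent ends s 𝓥) -
      prob p (clusterInEvent ends s {T : Set V | hv ∈ T} ∩ clusterInEvent ends s (𝓤A ∩ 𝓤B)) *
        prob p (clusterInEvent ends s 𝓥) -
      prob p (clusterInEvent ends s {T : Set V | hv ∈ T} ∩ clusterInEvent ends s 𝓥) *
        prob p (clusterInEvent ends s (𝓤A ∩ 𝓤B)) =
    prob (fun e => if e ∈ EA then p e else 0) (connEvent ends s x ∩ clusterInEvent ends s 𝓤A) *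
      ((1 - prob (fun e => if e ∈ EA then p e else 0) (connEvent ends s x)) *
          prob (fun e => if e ∈ EB then p e else 0)
            (clusterInEvent ends x {T : Set V | hv ∈ T} ∩ clusterInEvent ends x 𝓤B ∩
              clusterInEvent ends x 𝓥) +
        prob (fun e => if e ∈ EA then p e else 0) (connEvent ends s x) *
          (prob (fun e => if e ∈ EB then p e else 0)
              (clusterInEvent ends x {T : Set V | hv ∈ T} ∩ clusterInEvent ends x 𝓤B ∩
                clusterInEvent ends x 𝓥) +
            prob (fun e => if e ∈ EB then p e else 0) (clusterInEvent ends x {T : Set V | hv ∈ T}) *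
              prob (fun e => if e ∈ EB then p e else 0)
                (clusterInEvent ends x 𝓤B ∩ clusterInEvent ends x 𝓥) -
            prob (fun e => if e ∈ EB then p e else 0)
                (clusterInEvent ends x {T : Set V | hv ∈ T} ∩ clusterInEvent ends x 𝓤B) *
              prob (fun e => if e ∈ EB then p e else 0) (clusterInEvent ends x 𝓥) -
            prob (fun e => if e ∈ EB then p e else 0)
                (clusterInEvent ends x {T : Set V | hv ∈ T} ∩ clusterInEvent ends x 𝓥) *
              prob (fun e => if e ∈ EB then p e else 0) (clusterInEvent ends x 𝓤B))) := by
  have mQ : ∀ ω, ω ∈ clusterInEvent ends s {T : Set V | hv ∈ T} ↔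
      (restrict EA ω ∈ connEvent ends s x ∧
        restrict EB ω ∈ clusterInEvent ends x {T : Set V | hv ∈ T}) := fun ω => by
    rw [TCutVertex.hit_eq (EA := EA) h hs hvB]; exact Iff.rfl
  have mUB : ∀ ω, ω ∈ clusterInEvent ends s 𝓤B ↔
      (restrict EA ω ∈ connEvent ends s x ∧ restrict EB ω ∈ clusterInEvent ends x 𝓤B) := fun ω => by
    rw [TCutVertex.clusterInEvent_eq (EA := EA) h hs h𝓤B h𝓤B0]; exact Iff.rfl
  have mE : ∀ ω, ω ∈ clusterInEvent ends s 𝓥 ↔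
      (restrict EA ω ∈ connEvent ends s x ∧ restrict EB ω ∈ clusterInEvent ends x 𝓥) := fun ω => by
    rw [TCutVertex.clusterInEvent_eq (EA := EA) h hs h𝓥 h𝓥0]; exact Iff.rfl
  have mUA : ∀ ω, ω ∈ clusterInEvent ends s 𝓤A ↔ restrict EA ω ∈ clusterInEvent ends s 𝓤A := fun ω => by
    simp only [mem_clusterInEvent]
    rw [h𝓤A (cluster ends ω s), cluster_inter_eq h (Or.inl hs)]
  have mU : ∀ ω, ω ∈ clusterInEvent ends s (𝓤A ∩ 𝓤B) ↔
      (restrict EA ω ∈ clusterInEvent ends s 𝓤A ∧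
        (restrict EA ω ∈ connEvent ends s x ∧ restrict EB ω ∈ clusterInEvent ends x 𝓤B)) := fun ω => by
    rw [clusterInEvent_inter, Set.mem_inter_iff, mUA ω, mUB ω]
  have s1 : clusterInEvent ends s {T : Set V | hv ∈ T} ∩ clusterInEvent ends s (𝓤A ∩ 𝓤B) ∩
      clusterInEvent ends s 𝓥 =
      sideEvent EA (connEvent ends s x ∩ clusterInEvent ends s 𝓤A) ∩
        sideEvent EB (clusterInEvent ends x {T : Set V | hv ∈ T} ∩ clusterInEvent ends x 𝓤B ∩
          clusterInEvent ends x 𝓥) := by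
    ext ω
    simp only [Set.mem_inter_iff, mem_sideEvent]
    rw [mQ ω, mU ω, mE ω]; tauto
  have s2 : clusterInEvent ends s {T : Set V | hv ∈ T} =
      sideEvent EA (connEvent ends s x) ∩
        sideEvent EB (clusterInEvent ends x {T : Set V | hv ∈ T}) :=
    TCutVertex.hit_eq (EA := EA) h hs hvB
  have s3 : clusterInEvent ends s (𝓤A ∩ 𝓤B) ∩ clusterInEvent ends s 𝓥 =
      sideEvent EA (connEvent ends s x ∩ clusterInEvent ends s 𝓤A) ∩
        sideEvent EB (clusterInEvent ends x 𝓤B ∩ clusterInEvent ends x 𝓥) := by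
    ext ω
    simp only [Set.mem_inter_iff, mem_sideEvent]
    rw [mU ω, mE ω]; tauto
  have s4 : clusterInEvent ends s {T : Set V | hv ∈ T} ∩ clusterInEvent ends s (𝓤A ∩ 𝓤B) =
      sideEvent EA (connEvent ends s x ∩ clusterInEvent ends s 𝓤A) ∩
        sideEvent EB (clusterInEvent ends x {T : Set V | hv ∈ T} ∩ clusterInEvent ends x 𝓤B) := by
    ext ω
    simp only [Set.mem_inter_iff, mem_sideEvent]
    rw [mQ ω, mU ω]; tauto
  have s5 : clusterInEvent ends s 𝓥 =
      sideEvent EA (connEvent ends s x) ∩ sideEvent EB (clusterInEvent ends x 𝓥) :=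
    TCutVertex.clusterInEvent_eq (EA := EA) h hs h𝓥 h𝓥0
  have s6 : clusterInEvent ends s {T : Set V | hv ∈ T} ∩ clusterInEvent ends s 𝓥 =
      sideEvent EA (connEvent ends s x) ∩
        sideEvent EB (clusterInEvent ends x {T : Set V | hv ∈ T} ∩ clusterInEvent ends x 𝓥) := by
    ext ω
    simp only [Set.mem_inter_iff, mem_sideEvent]
    rw [mQ ω, mE ω]; tauto
  have s7 : clusterInEvent ends s (𝓤A ∩ 𝓤B) =
      sideEvent EA (connEvent ends s x ∩ clusterInEvent ends s 𝓤A) ∩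
        sideEvent EB (clusterInEvent ends x 𝓤B) := by
    ext ω
    simp only [Set.mem_inter_iff, mem_sideEvent]
    rw [mU ω]; tauto
  have p1 := congrArg (prob p) s1
  have p2 := congrArg (prob p) s2
  have p3 := congrArg (prob p) s3
  have p4 := congrArg (prob p) s4
  have p5 := congrArg (prob p) s5
  have p6 := congrArg (prob p) s6
  have p7 := congrArg (prob p) s7
  rw [prob_side_inter_side' p h] at p1 p2 p3 p4 p5 p6 p7
  rw [p1, p4, p6, p2, p3, p5, p7]
  ring

/-- **(T_h) transfers across a cut vertex for the mixed up-set `𝓤_A ∩ 𝓤_B`.** -/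
theorem t_of_cut_and (p : E → R) (hp : IsProbVec p) (h : IsCut ends x VA VB EA EB) {s hv : V}
    (hs : s ∈ VA) (hvB : hv ∈ VB) {𝓤A 𝓤B 𝓥 : Set (Set V)}
    (h𝓤A : ∀ S, S ∈ 𝓤A ↔ S ∩ (VA ∪ {x}) ∈ 𝓤A)
    (h𝓤B : ∀ S, S ∈ 𝓤B ↔ S ∩ VB ∈ 𝓤B) (h𝓤B0 : ∅ ∉ 𝓤B)
    (h𝓥 : ∀ S, S ∈ 𝓥 ↔ S ∩ VB ∈ 𝓥) (h𝓥0 : ∅ ∉ 𝓥)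
    (hB : prob (fun e => if e ∈ EB then p e else 0)
            (clusterInEvent ends x {T : Set V | hv ∈ T} ∩ clusterInEvent ends x 𝓤B) *
          prob (fun e => if e ∈ EB then p e else 0) (clusterInEvent ends x 𝓥) +
        prob (fun e => if e ∈ EB then p e else 0) (clusterInEvent ends x 𝓤B) *
          prob (fun e => if e ∈ EB then p e else 0)
            (clusterInEvent ends x {T : Set V | hv ∈ T} ∩ clusterInEvent ends x 𝓥) ≤
        prob (fun e => if e ∈ EB then p e else 0)
            (clusterInEvent ends x {T : Set V | hv ∈ T} ∩ clusterInEvent ends x 𝓤B ∩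
              clusterInEvent ends x 𝓥) +
          prob (fun e => if e ∈ EB then p e else 0) (clusterInEvent ends x {T : Set V | hv ∈ T}) *
            prob (fun e => if e ∈ EB then p e else 0)
              (clusterInEvent ends x 𝓤B ∩ clusterInEvent ends x 𝓥)) :
    prob p (clusterInEvent ends s {T : Set V | hv ∈ T} ∩ clusterInEvent ends s (𝓤A ∩ 𝓤B)) *
        prob p (clusterInEvent ends s 𝓥) +
      prob p (clusterInEvent ends s (𝓤A ∩ 𝓤B)) *
        prob p (clusterInEvent ends s {T : Set V | hv ∈ T} ∩ clusterInEvent ends s 𝓥) ≤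
      prob p (clusterInEvent ends s {T : Set V | hv ∈ T} ∩ clusterInEvent ends s (𝓤A ∩ 𝓤B) ∩
          clusterInEvent ends s 𝓥) +
        prob p (clusterInEvent ends s {T : Set V | hv ∈ T}) *
          prob p (clusterInEvent ends s (𝓤A ∩ 𝓤B) ∩ clusterInEvent ends s 𝓥) := by
  have hid := t_cut_and_identity p h hs hvB h𝓤A h𝓤B h𝓤B0 h𝓥 h𝓥0
  have hpA : IsProbVec (fun e => if e ∈ EA then p e else 0) := CDCutVertex.isProbVec_zeroOff hp EA
  have hpB : IsProbVec (fun e => if e ∈ EB then p e else 0) := CDCutVertex.isProbVec_zeroOff hp EB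
  have hα : 0 ≤ prob (fun e => if e ∈ EA then p e else 0)
      (connEvent ends s x ∩ clusterInEvent ends s 𝓤A) := prob_nonneg hpA _
  have hξ1 : 0 ≤ 1 - prob (fun e => if e ∈ EA then p e else 0) (connEvent ends s x) :=
    sub_nonneg.2 (prob_le_one hpA _)
  have hξ0 : 0 ≤ prob (fun e => if e ∈ EA then p e else 0) (connEvent ends s x) := prob_nonneg hpA _
  have hque : 0 ≤ prob (fun e => if e ∈ EB then p e else 0)
      (clusterInEvent ends x {T : Set V | hv ∈ T} ∩ clusterInEvent ends x 𝓤B ∩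
        clusterInEvent ends x 𝓥) := prob_nonneg hpB _
  have hTB : 0 ≤ prob (fun e => if e ∈ EB then p e else 0)
            (clusterInEvent ends x {T : Set V | hv ∈ T} ∩ clusterInEvent ends x 𝓤B ∩
              clusterInEvent ends x 𝓥) +
          prob (fun e => if e ∈ EB then p e else 0) (clusterInEvent ends x {T : Set V | hv ∈ T}) *
            prob (fun e => if e ∈ EB then p e else 0)
              (clusterInEvent ends x 𝓤B ∩ clusterInEvent ends x 𝓥) -
          prob (fun e => if e ∈ EB then p e else 0)
              (clusterInEvent ends x {T : Set V | hv ∈ T} ∩ clusterInEvent ends x 𝓤B) *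
            prob (fun e => if e ∈ EB then p e else 0) (clusterInEvent ends x 𝓥) -
          prob (fun e => if e ∈ EB then p e else 0)
              (clusterInEvent ends x {T : Set V | hv ∈ T} ∩ clusterInEvent ends x 𝓥) *
            prob (fun e => if e ∈ EB then p e else 0) (clusterInEvent ends x 𝓤B) := by linarith
  have h1 := mul_nonneg hα (add_nonneg (mul_nonneg hξ1 hque) (mul_nonneg hξ0 hTB))
  linarith [hid, h1]

end And

end TCutVertexAnd

end Summit.Ventures.PercRepro2
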